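import Summits.ResolutionOfSingularities.ResolutionOfSingularities.Theorems.DeltaCutChainCertificates
import HarnessLib

/-!
# DeltaCutChainCertificates2 — decomp-res node «ChainCut» (lens-6 g24, critic row 185 CLEARED DECIDED +1 · MAP 0),
tree file 5/5 of the node

Content VERBATIM from the decomp-res lens-6 g24 node `HOME/decomp-res-lens-6/g24/ChainCut.lean` (pin dd25c369;
imports the landed tree only, carries nothing); HOME = run/shared/lean/pub/decomp-res; critic row 185 CLEARED
DECIDED +1 · MAP 0; landing orders INBOX :962/:964/:980 — provenance, critic text and the lens header in full in the
first file of the node, `DeltaCutChain`.  Namespace `…Theorems.DeltaCutClasses`; `--supports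
stmt-ResolutionOfSingularities-26971`.

## This file

Continuation 2/2 of `DeltaCutChainCertificates` (same sections of the node, cut at the 400-line cap): carries
`tame_successor_quartic_w`, `R2_chainTame_certificate`, `BS_isolated`, `X_pow_mul_mem_spanX4_pow`,
`BS_chain_certificate`, `Cax_curve_certificate`.

[WRITER NOTE (decomp-res writer g12): file split only (tree files ≤ 400 lines); namespace, sections, section
variables / opens and every declaration exactly as in the lens (the node's global dupNamespace-linter line is
dropped — the library sets it). The four chart lemmas `f_self` / `f_ne` / `f_two` / `f_one` of `section
chart_lemmas4` lose their `private` modifier — the only non-verbatim token change: `DeltaCutChainCertificates2` uses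
them across the file split and `private` names do not cross module boundaries (no name clash in `…DeltaCutClasses`).]

(Sources: Hironaka1967 (characteristic polyhedra); CossartJannsenSaito2020 Def. 3.13 / Thm. 3.14, Ch. 8, Thm. 9.6;
Hironaka1970 (near points / vertices); CossartPiltant2019 Prop. 2.6 (δ at chart origins); CossartPiltant2008 §2;
Giraud1975; Hironaka2005 (three key theorems: order under permissible blow-up); EGAIV4 §16–§17; StacksProject 0804 /
0BIQ / 031I; Matsumura1987 §28.)
-/

noncomputable section

open CategoryTheory CategoryTheory.Limits AlgebraicGeometry TopologicalSpace IsLocalRing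
open Literature.AlgebraicGeometry.Resolution

universe u

namespace Summit.ResolutionOfSingularities.ResolutionOfSingularities.Theorems.DeltaCutClasses

open Summit.ResolutionOfSingularities.ResolutionOfSingularities.Theorems.TwistCutClasses
open Summit.ResolutionOfSingularities.ResolutionOfSingularities.Theorems.LightCutClasses

section ChainCertificates

open MvPolynomial
variable {K : Type*} [Field K]

/-- **R2 (III), chart `w` mirror of the tree's `LightCutClasses.tame_successor_quartic`**: `∂_{u'}∂_{u'} f'_w = 2w`.
[new; elementary] [folklore] -/
theorem tame_successor_quartic_w :
    (pderiv 2) ((pderiv 2) (X 0 ^ 3 + X 3 * (X 2 ^ 2 + X 1 ^ 4) : MvPolynomial (Fin 4) K)) = 2 * X 3 := by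
  have e20 := f_ne K (i := 2) (j := 0) (by decide)
  have e21 := f_ne K (i := 2) (j := 1) (by decide)
  have e23 := f_ne K (i := 2) (j := 3) (by decide)
  have e22 := f_self K 2
  have h1 : (pderiv 2) (X 0 ^ 3 + X 3 * (X 2 ^ 2 + X 1 ^ 4) : MvPolynomial (Fin 4) K) = 2 * X 3 * X 2 := by
    simp only [map_add, Derivation.leibniz, Derivation.leibniz_pow, smul_eq_mul, nsmul_eq_mul, e20, e21, e22, e23]
    push_cast; ring
  rw [h1]
  simp only [Derivation.leibniz, smul_eq_mul, e22, e23, f_two]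
  ring

/-- **ONE KERNEL STATEMENT — R2 IS CHAIN-TAME (the DECIDED-side inhabitant of the chain cut).**  Over every field of
characteristic `3`:
(I) Sing₃ = {origin} (`R2_isolated`: the bad set is finite); (II) the near points over the origin are EXACTLY the origins of the
charts `u` and `w` (none in charts `t`, `z`; only the origin in charts `u`, `w`); (III) at each of them an absolute differential
operator of order `2 = n − 1` extracts the exceptional parameter (`∂²f' = 2·u`, resp. `2·w`), a REGULAR PARAMETER of
the chart origin
`𝔫₀` (`∉ 𝔫₀²`): both near points are absolute-contact (TAME) points, so R2 has NO WILD NEAR POINT — the chain letter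
`ChainLightAt`
holds VACUOUSLY and the finiteness letter holds: R2 ∈ `WORTopDeltaHeavyChainTame 3`'s data, δ-heavy (g23
`R2_deltaHeavy_chart_u`)
yet DECIDED. [new; elementary] [folklore] -/
theorem R2_chainTame_certificate [CharP K 3] :
    (∀ (𝔮 : Ideal (MvPolynomial (Fin 4) K)), 𝔮.IsPrime → ∀ s ∉ 𝔮,
      s * (X 0 ^ 3 + X 1 ^ 4 + X 2 ^ 2 * X 3 ^ 2 : MvPolynomial (Fin 4) K) ∈ 𝔮 ^ 3 →
        (X 0 : MvPolynomial (Fin 4) K) ∈ 𝔮 ∧ (X 1 : MvPolynomial (Fin 4) K) ∈ 𝔮 ∧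
          (X 2 : MvPolynomial (Fin 4) K) ∈ 𝔮 ∧ (X 3 : MvPolynomial (Fin 4) K) ∈ 𝔮) ∧
    (∀ (𝔫 : Ideal (MvPolynomial (Fin 4) K)), 𝔫.IsPrime → (X 1 : MvPolynomial (Fin 4) K) ∈ 𝔫 → ∀ s ∉ 𝔫,
      s * (X 0 ^ 3 + X 1 * (1 + X 2 ^ 2 * X 3 ^ 2) : MvPolynomial (Fin 4) K) ∉ 𝔫 ^ 3) ∧
    (∀ (𝔫 : Ideal (MvPolynomial (Fin 4) K)), 𝔫.IsPrime → (X 0 : MvPolynomial (Fin 4) K) ∈ 𝔫 → ∀ s ∉ 𝔫,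
      s * (1 + X 0 * (X 1 ^ 4 + X 2 ^ 2 * X 3 ^ 2) : MvPolynomial (Fin 4) K) ∉ 𝔫 ^ 3) ∧
    (∀ (𝔫 : Ideal (MvPolynomial (Fin 4) K)), 𝔫.IsPrime → (X 2 : MvPolynomial (Fin 4) K) ∈ 𝔫 → ∀ s ∉ 𝔫,
      s * (X 0 ^ 3 + X 2 * (X 3 ^ 2 + X 1 ^ 4) : MvPolynomial (Fin 4) K) ∈ 𝔫 ^ 3 →
        (X 0 : MvPolynomial (Fin 4) K) ∈ 𝔫 ∧ (X 1 : MvPolynomial (Fin 4) K) ∈ 𝔫 ∧ (X 3 : MvPolynomial (Fin 4) K) ∈ 𝔫) ∧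
    (∀ (𝔫 : Ideal (MvPolynomial (Fin 4) K)), 𝔫.IsPrime → (X 3 : MvPolynomial (Fin 4) K) ∈ 𝔫 → ∀ s ∉ 𝔫,
      s * (X 0 ^ 3 + X 3 * (X 2 ^ 2 + X 1 ^ 4) : MvPolynomial (Fin 4) K) ∈ 𝔫 ^ 3 →
        (X 0 : MvPolynomial (Fin 4) K) ∈ 𝔫 ∧ (X 1 : MvPolynomial (Fin 4) K) ∈ 𝔫 ∧ (X 2 : MvPolynomial (Fin 4) K) ∈ 𝔫) ∧
    ((pderiv 3) ((pderiv 3) (X 0 ^ 3 + X 2 * (X 3 ^ 2 + X 1 ^ 4) : MvPolynomial (Fin 4) K)) = 2 * X 2 ∧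
      (X 2 : MvPolynomial (Fin 4) K) ∉ (Ideal.span {(X 0 : MvPolynomial (Fin 4) K), X 1, X 2, X 3}) ^ 2) ∧
    ((pderiv 2) ((pderiv 2) (X 0 ^ 3 + X 3 * (X 2 ^ 2 + X 1 ^ 4) : MvPolynomial (Fin 4) K)) = 2 * X 3 ∧
      (X 3 : MvPolynomial (Fin 4) K) ∉ (Ideal.span {(X 0 : MvPolynomial (Fin 4) K), X 1, X 2, X 3}) ^ 2) :=
  ⟨fun 𝔮 _ _ hs h => R2_isolated 𝔮 hs h, fun 𝔫 _ ht _ hs => R2_noNear_chart_t 𝔫 ht hs,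
    fun 𝔫 _ hz _ hs => R2_noNear_chart_z 𝔫 hz hs, fun 𝔫 _ hu _ hs h => R2_near_chart_u_only 𝔫 hu hs h,
    fun 𝔫 _ hw _ hs h => R2_near_chart_w_only 𝔫 hw hs h, ⟨tame_successor_quartic, X_not_mem_spanX4_sq 2⟩,
    ⟨tame_successor_quartic_w, X_not_mem_spanX4_sq 3⟩⟩

/-! #### B_S = `z³ + t⁷ + u⁷ + w⁷`: Sing₃ = {0}, with a δ-heavy WILD near-point chain of length 2 -/

/-- **B_S (I) — Sing₃(B_S) = {0}**: every prime of order `≥ 3` for `z³ + t⁷ + u⁷ + w⁷` contains `z, t, u, w` (`∂ f =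
7x⁶` per variable).
[new; elementary] [folklore] -/
theorem BS_isolated [CharP K 3] (𝔮 : Ideal (MvPolynomial (Fin 4) K)) [𝔮.IsPrime] {s : MvPolynomial (Fin 4) K}
    (hs : s ∉ 𝔮) (h : s * (X 0 ^ 3 + X 1 ^ 7 + X 2 ^ 7 + X 3 ^ 7 : MvPolynomial (Fin 4) K) ∈ 𝔮 ^ 3) :
    (X 0 : MvPolynomial (Fin 4) K) ∈ 𝔮 ∧ (X 1 : MvPolynomial (Fin 4) K) ∈ 𝔮 ∧
      (X 2 : MvPolynomial (Fin 4) K) ∈ 𝔮 ∧ (X 3 : MvPolynomial (Fin 4) K) ∈ 𝔮 := by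
  have hs2 : s ^ 2 ∉ 𝔮 := pow_not_mem 𝔮 hs 2
  have h7 : (7 : MvPolynomial (Fin 4) K) ∉ 𝔮 := by
    have := natCast_not_mem (K := K) 𝔮 (m := 7) (by decide)
    exact_mod_cast this
  have e10 := f_ne K (i := 1) (j := 0) (by decide)
  have e12 := f_ne K (i := 1) (j := 2) (by decide)
  have e13 := f_ne K (i := 1) (j := 3) (by decide)
  have e20 := f_ne K (i := 2) (j := 0) (by decide)
  have e21 := f_ne K (i := 2) (j := 1) (by decide)
  have e23 := f_ne K (i := 2) (j := 3) (by decide)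
  have e30 := f_ne K (i := 3) (j := 0) (by decide)
  have e31 := f_ne K (i := 3) (j := 1) (by decide)
  have e32 := f_ne K (i := 3) (j := 2) (by decide)
  have e11 := f_self K 1
  have e22 := f_self K 2
  have e33 := f_self K 3
  have d1 : pderiv 1 (X 0 ^ 3 + X 1 ^ 7 + X 2 ^ 7 + X 3 ^ 7 : MvPolynomial (Fin 4) K) = 7 * X 1 ^ 6 := by
    simp only [map_add, Derivation.leibniz_pow, smul_eq_mul, nsmul_eq_mul, e10, e11, e12, e13]
    push_cast; ring
  have d2 : pderiv 2 (X 0 ^ 3 + X 1 ^ 7 + X 2 ^ 7 + X 3 ^ 7 : MvPolynomial (Fin 4) K) = 7 * X 2 ^ 6 := by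
    simp only [map_add, Derivation.leibniz_pow, smul_eq_mul, nsmul_eq_mul, e20, e21, e22, e23]
    push_cast; ring
  have d3 : pderiv 3 (X 0 ^ 3 + X 1 ^ 7 + X 2 ^ 7 + X 3 ^ 7 : MvPolynomial (Fin 4) K) = 7 * X 3 ^ 6 := by
    simp only [map_add, Derivation.leibniz_pow, smul_eq_mul, nsmul_eq_mul, e30, e31, e32, e33]
    push_cast; ring
  have hX1 : (X 1 : MvPolynomial (Fin 4) K) ∈ 𝔮 := by
    have := sq_mul_deriv_mem_pow 𝔮 h (pderiv 1)
    rw [d1] at this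
    exact mem_of_mul_mul_pow_mem_pow 𝔮 two_ne_zero hs2 h7 this
  have hX2 : (X 2 : MvPolynomial (Fin 4) K) ∈ 𝔮 := by
    have := sq_mul_deriv_mem_pow 𝔮 h (pderiv 2)
    rw [d2] at this
    exact mem_of_mul_mul_pow_mem_pow 𝔮 two_ne_zero hs2 h7 this
  have hX3 : (X 3 : MvPolynomial (Fin 4) K) ∈ 𝔮 := by
    have := sq_mul_deriv_mem_pow 𝔮 h (pderiv 3)
    rw [d3] at this
    exact mem_of_mul_mul_pow_mem_pow 𝔮 two_ne_zero hs2 h7 this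
  have hf : (X 0 ^ 3 + X 1 ^ 7 + X 2 ^ 7 + X 3 ^ 7 : MvPolynomial (Fin 4) K) ∈ 𝔮 :=
    (‹𝔮.IsPrime›.mem_or_mem (Ideal.pow_le_self three_ne_zero h)).resolve_left hs
  have hX0 : (X 0 : MvPolynomial (Fin 4) K) ∈ 𝔮 := by
    refine ‹𝔮.IsPrime›.mem_of_pow_mem 3 ?_
    have := Ideal.sub_mem _ hf (Ideal.add_mem _ (Ideal.add_mem _ (Ideal.pow_mem_of_mem 𝔮 hX1 7 (by norm_num))
      (Ideal.pow_mem_of_mem 𝔮 hX2 7 (by norm_num))) (Ideal.pow_mem_of_mem 𝔮 hX3 7 (by norm_num)))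
    rwa [show (X 0 ^ 3 + X 1 ^ 7 + X 2 ^ 7 + X 3 ^ 7 - (X 1 ^ 7 + X 2 ^ 7 + X 3 ^ 7) : MvPolynomial (Fin 4) K) = X 0 ^ 3
      by ring] at this
  exact ⟨hX0, hX1, hX2, hX3⟩

/-- `Xᵢ^a · q ∈ 𝔫₀^a`. [elementary] [folklore] -/
theorem X_pow_mul_mem_spanX4_pow (i : Fin 4) (a : ℕ) (q : MvPolynomial (Fin 4) K) :
    (X i ^ a * q : MvPolynomial (Fin 4) K) ∈ (Ideal.span {(X 0 : MvPolynomial (Fin 4) K), X 1, X 2, X 3}) ^ a :=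
  Ideal.mul_mem_right _ _ (Ideal.pow_mem_pow (X_mem_spanX4 i) a)

/-- **ONE KERNEL STATEMENT — B_S HAS A δ-HEAVY WILD NEAR-POINT CHAIN OF LENGTH 2 (the RESIDUAL-side inhabitant, finite-chain
kind).**  Over every field of characteristic `3`, with B_S = `z³ + t⁷ + u⁷ + w⁷`, `n = 3`:
(I) Sing₃ = {origin} (`BS_isolated`: ONE bad point) — so B_S is NOT of the infinite kind;
(II) `3`-POWER FORMS `z³ + (𝔫₀⁴)` downstairs AND at the chart-`t` origin `y'` (`f'_t = z'³ + t⁴(1 + u'⁷ + w'⁷)`, `0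
= z', 1 = t, 2 = u',
3 = w'`): both points are WILD (no absolute contact; tree dictionary
`HugValuationCut.isAbsContactAt_iff_not_pPowerFormAt_closed`, Theorems/ContactFreeIsPPower);
(III) `y'` is a NEAR point of the origin (`f'_t ∈ 𝔫'³`) and the chart-`u'` origin `y''` of the blow-up at `y'` is a
NEAR point of `y'`
(`f'' = z''³ + u' t''⁴(1 + u'⁷ + u'⁷w''⁷) ∈ 𝔫''³`, `0 = z'', 1 = t'', 2 = u', 3 = w''`): by (N) at `y'` the wild
near point `y'` is
NOT δ-light — `ChainLightAt` FAILS at the origin of B_S, its only bad point: B_S ∈ `WORTopFiniteChainHeavy 3`'s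
data. [new; elementary] [folklore] -/
theorem BS_chain_certificate [CharP K 3] :
    (∀ (𝔮 : Ideal (MvPolynomial (Fin 4) K)), 𝔮.IsPrime → ∀ s ∉ 𝔮,
      s * (X 0 ^ 3 + X 1 ^ 7 + X 2 ^ 7 + X 3 ^ 7 : MvPolynomial (Fin 4) K) ∈ 𝔮 ^ 3 →
        (X 0 : MvPolynomial (Fin 4) K) ∈ 𝔮 ∧ (X 1 : MvPolynomial (Fin 4) K) ∈ 𝔮 ∧
          (X 2 : MvPolynomial (Fin 4) K) ∈ 𝔮 ∧ (X 3 : MvPolynomial (Fin 4) K) ∈ 𝔮) ∧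
    (∃ r : MvPolynomial (Fin 4) K, r ∈ (Ideal.span {(X 0 : MvPolynomial (Fin 4) K), X 1, X 2, X 3}) ^ (3 + 1) ∧
      (X 0 ^ 3 + X 1 ^ 7 + X 2 ^ 7 + X 3 ^ 7 : MvPolynomial (Fin 4) K) = X 0 ^ 3 + r) ∧
    (∃ r : MvPolynomial (Fin 4) K, r ∈ (Ideal.span {(X 0 : MvPolynomial (Fin 4) K), X 1, X 2, X 3}) ^ (3 + 1) ∧
      (X 0 ^ 3 + X 1 ^ 4 * (1 + X 2 ^ 7 + X 3 ^ 7) : MvPolynomial (Fin 4) K) = X 0 ^ 3 + r) ∧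
    (X 0 ^ 3 + X 1 ^ 4 * (1 + X 2 ^ 7 + X 3 ^ 7) : MvPolynomial (Fin 4) K) ∈
      (Ideal.span {(X 0 : MvPolynomial (Fin 4) K), X 1, X 2, X 3}) ^ 3 ∧
    (X 0 ^ 3 + X 2 * X 1 ^ 4 * (1 + X 2 ^ 7 + X 2 ^ 7 * X 3 ^ 7) : MvPolynomial (Fin 4) K) ∈
      (Ideal.span {(X 0 : MvPolynomial (Fin 4) K), X 1, X 2, X 3}) ^ 3 := by
  refine ⟨fun 𝔮 _ _ hs h => BS_isolated 𝔮 hs h, ⟨X 1 ^ 7 + X 2 ^ 7 + X 3 ^ 7, ?_, by ring⟩,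
    ⟨X 1 ^ 4 * (1 + X 2 ^ 7 + X 3 ^ 7), ?_, rfl⟩, ?_, ?_⟩
  · have h7 : ∀ i : Fin 4, (X i ^ 7 : MvPolynomial (Fin 4) K) ∈
        (Ideal.span {(X 0 : MvPolynomial (Fin 4) K), X 1, X 2, X 3}) ^ (3 + 1) := by
      intro i
      have h := X_pow_mul_mem_spanX4_pow (K := K) i 7 1
      rw [mul_one] at h
      exact Ideal.pow_le_pow_right (by norm_num : 3 + 1 ≤ 7) h
    exact Ideal.add_mem _ (Ideal.add_mem _ (h7 1) (h7 2)) (h7 3)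
  · exact X_pow_mul_mem_spanX4_pow 1 4 _
  · refine Ideal.add_mem _ (Ideal.pow_mem_pow (X_mem_spanX4 0) 3) ?_
    exact Ideal.pow_le_pow_right (by norm_num) (X_pow_mul_mem_spanX4_pow (K := K) 1 4 _)
  · refine Ideal.add_mem _ (Ideal.pow_mem_pow (X_mem_spanX4 0) 3) ?_
    have : (X 2 * X 1 ^ 4 * (1 + X 2 ^ 7 + X 2 ^ 7 * X 3 ^ 7) : MvPolynomial (Fin 4) K) =
        X 1 ^ 4 * (X 2 * (1 + X 2 ^ 7 + X 2 ^ 7 * X 3 ^ 7)) := by ring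
    rw [this]
    exact Ideal.pow_le_pow_right (by norm_num) (X_pow_mul_mem_spanX4_pow (K := K) 1 4 _)

/-! #### C_ax = `z³ + t⁴ + u⁴`: the INFINITE kind (the whole `w`-axis consists of bad points) -/

/-- **ONE KERNEL STATEMENT — C_ax INHABITS THE INFINITE-BAD-SET KIND.**  With C_ax = `z³ + t⁴ + u⁴ ∈ K[z,t,u,w]`, `n
= 3`: the prime
`P = (z,t,u)` of the `w`-AXIS (a curve: `P ≠ 𝔫₀`, `w ∉ P`; infinitely many closed points) has `f ∈ P³` (order `≥ 3`
along the whole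
axis) and `f = z³ + r`, `r ∈ P⁴` — the `3`-POWER FORM at EVERY closed point `c` of the axis (`z` a regular parameter
there): every
such `c` is a WILD top point; and it is δ-HEAVY: with `X₃` read as the local parameter of `c` on the axis (`w − γ`,
or an irreducible
`g(w)`), the chart-`X₃` origin over `c` is a near point, `f' = z'³ + X₃(t'⁴ + u'⁴) ∈ 𝔫'³` (`0 = z', 1 = t', 2 = u',
3 = X₃`).  Hence
INFINITELY MANY bad points: C_ax ∈ `WORTopBadInfinite 3`'s data. [new; elementary] [folklore] -/
theorem Cax_curve_certificate :
    (X 0 ^ 3 + X 1 ^ 4 + X 2 ^ 4 : MvPolynomial (Fin 4) K) ∈ (Ideal.span {(X 0 : MvPolynomial (Fin 4) K), X 1, X 2}) ^ 3 ∧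
    (X 3 : MvPolynomial (Fin 4) K) ∉ Ideal.span {(X 0 : MvPolynomial (Fin 4) K), X 1, X 2} ∧
    (∃ r : MvPolynomial (Fin 4) K, r ∈ (Ideal.span {(X 0 : MvPolynomial (Fin 4) K), X 1, X 2}) ^ (3 + 1) ∧
      (X 0 ^ 3 + X 1 ^ 4 + X 2 ^ 4 : MvPolynomial (Fin 4) K) = X 0 ^ 3 + r) ∧
    (X 0 ^ 3 + X 3 * (X 1 ^ 4 + X 2 ^ 4) : MvPolynomial (Fin 4) K) ∈
      (Ideal.span {(X 0 : MvPolynomial (Fin 4) K), X 1, X 2, X 3}) ^ 3 := by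
  have hP : ∀ j : Fin 3, (X (Fin.castSucc j) : MvPolynomial (Fin 4) K) ∈
      Ideal.span {(X 0 : MvPolynomial (Fin 4) K), X 1, X 2} := by
    intro j; fin_cases j <;> exact Ideal.subset_span (by simp)
  refine ⟨?_, ?_, ⟨X 1 ^ 4 + X 2 ^ 4, ?_, by ring⟩, ?_⟩
  · refine Ideal.add_mem _ (Ideal.add_mem _ (Ideal.pow_mem_pow (hP 0) 3) ?_) ?_
    · exact Ideal.pow_le_pow_right (by norm_num) (Ideal.pow_mem_pow (hP 1) 4)
    · exact Ideal.pow_le_pow_right (by norm_num) (Ideal.pow_mem_pow (hP 2) 4)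
  · intro h
    have hle : Ideal.span {(X 0 : MvPolynomial (Fin 4) K), X 1, X 2} ≤
        RingHom.ker (eval (fun i : Fin 4 => if i = 3 then (1 : K) else 0)) := by
      refine Ideal.span_le.2 ?_
      rintro q hq
      simp only [Set.mem_insert_iff, Set.mem_singleton_iff] at hq
      rcases hq with rfl | rfl | rfl <;> simp [RingHom.mem_ker]
    have h3 := hle h
    rw [RingHom.mem_ker, eval_X] at h3
    simp at h3
  · exact Ideal.add_mem _ (Ideal.pow_mem_pow (hP 1) (3 + 1)) (Ideal.pow_mem_pow (hP 2) (3 + 1))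
  · refine Ideal.add_mem _ (Ideal.pow_mem_pow (X_mem_spanX4 0) 3) ?_
    have : (X 3 * (X 1 ^ 4 + X 2 ^ 4) : MvPolynomial (Fin 4) K) = X 1 ^ 4 * X 3 + X 2 ^ 4 * X 3 := by ring
    rw [this]
    exact Ideal.add_mem _ (Ideal.pow_le_pow_right (by norm_num) (X_pow_mul_mem_spanX4_pow (K := K) 1 4 _))
      (Ideal.pow_le_pow_right (by norm_num) (X_pow_mul_mem_spanX4_pow (K := K) 2 4 _))

end ChainCertificates

end Summit.ResolutionOfSingularities.ResolutionOfSingularities.Theorems.DeltaCutClasses
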